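/-
Copyright (c) 2026 the pub-hodgecm2 formalisation cell (harness21).  New file, outside the frozen port manifest.
Origin: ASSEMBLER `planner-pub-hodgecm2-d2bridge-plan-g2-0` (draft bytes, HOME/INBOX l.11453) re-homed and owned by the SOCKET-SPEC seat `prover-pub-hodgecm2-d2bridge-socket-1-g0-0`;
filer of record = a Δ2 prover seat), 2026-08-23.  THE (c)+(d) SOCKET of the Δ2 bridge: the five residual binders
`M ∕ jH ∕ hjHinj ∕ hjH ∕ pieces` of tonight's END (`PortJoin/ClosedPrinted.lean` §A, ASSEMBLER DECISION #13) bundled as ONE structure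
`SocketCD F h6 V a₀ h Φ` at the ι₁ pin of record, field types LITERALLY the END §A binder types (= the slots of ✔
`PinSignatures.thm418C_liuDictionaryPin_of_pins`, p370763, at the rests of record `(uniformOmegaRep … (2 * imagUnit F)⁻¹ …).rest
(restTailOne (AlgHom.id ℚ F) ι₁ …)` — own-htheta ✔ p370765, F4 ✔ p370447 `δ′ = (2δ_F)⁻¹` EXACT); the PLUG theorem
`thm418C_indexOfRecord_of_socket` (= END §A with the five binders drawn from the socket) is the sibling `SocketCDPlug.lean`.  Every
wall-breaker route targets `SocketCD …` BY VALUE (`SocketCD.mk M jH hjHinj hjH pieces` or `⟨M, jH, hjHinj, hjH, pieces⟩`) and the END consumes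
the five projections.  KERNEL: one structure (pure packaging of the five binder types, no new mathematical definition); no theorem, no
instance, no named fact, no `sorry`.  HC_CM is NOT proved; NOT «Δ2 BRIDGE CLOSED»; no inhabitant
of the socket is claimed here — ORIENTATION of the ι₁-keyed dictionary classes relative to the tower's complex structure is UNDER AUDIT
(ORIENTATION-MEMO v1.1 §3, DECISION #14): at index lines with `PhiMuLine` and `block i ≠ ⊥` an inhabitant may not exist in branch (c-S);
the socket is where the kernel decides it.
-/
import Summits.HodgeConjecture.CorCM.PortJoin.HMDischargeLocal
import Summits.HodgeConjecture.CorCM.D2Bridge.PinSignatures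
import Summits.HodgeConjecture.CorCM.B01.Transposition.Item6UniformOmegaRep
import Summits.HodgeConjecture.CorCM.D2Bridge.OmegaAtDeltaPrime
import Literature.NumberTheory.GelbartRogawski1991.UnitaryDualPairThetaKernelCMKTypeFin
import Literature.NumberTheory.Automorphic.Liu2021.AppendixC.Prop413DataOfRestOne
import Literature.NumberTheory.Automorphic.Liu2021.AppendixC.UniformOmegaCiteLegs
import Literature.NumberTheory.Automorphic.Liu2021.Def45RMuFormSupply
import Literature.AlgebraicGeometry.ComplexMultiplication.CMAbelianVarietyRealisedHolds
import HarnessLib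

set_option autoImplicit false

/-!
# The (c)+(d) socket of the Δ2 bridge at the pinned dictionary of record

* `SocketCD F h6 V a₀ h Φ` — per index line `i : I V (repAt a₀) (muLiu ι₁ rep)` and every conjugate-symplectic weight-one `μ`, at the
  rest of record `R := (uniformOmegaRep …).rest (restTailOne (AlgHom.id ℚ F) ι₁ hμ hw …)`: `M i μ hμ hw : (toThm418Data C R).Map43RationalData`
  (the rational (4.3) record), `jH i μ hμ hw : (M …).HB →ₗ[ℂ] (liuDictionaryPin …).H`, `hjHinj` (injective), `hjH` (`ℂ[U(V)(𝔸_f)]`-equivariant),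
  `pieces i μ hμ hw K hK : HcmPieces (toThm418Data C R) (M …) H (jH …) K.K (CohC (pms F ι₁ V K) 1) (resTotal … K) (cmClasses K i)` for
  `K ≤ Level.capThree C.S.K₀`.
* The PLUG theorem `thm418C_indexOfRecord_of_socket` (END §A with the five binders := `S.M ∕ S.jH ∕ S.hjHinj ∕ S.hjH ∕ S.pieces`) lives in
  the sibling `CorCM/D2Bridge/SocketCDPlug.lean` (kept apart so that this statement file elaborates fast and imports stay what they are).
-/

noncomputable section

open scoped TensorProduct Matrix

namespace Summit.HodgeConjecture.CorCM.D2Bridge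

open NumberField NumberField.InfinitePlace
open HodgeCM.Model HodgeCM.Model.LiuIndex HodgeCM.Model.TowerCarrier
open HodgeCM.Literature.Theta.LiuAlbaneseModuleDatum.D2Bridge (HcmPieces)
open Summit.HodgeConjecture.CorCM.Model
open Literature.AlgebraicGeometry.Motives (CMType)
open Literature.AlgebraicGeometry.HodgeTheory Literature.NumberTheory.Automorphic.PicardCM
open Literature.AlgebraicGeometry.ShimuraVarieties.UnitaryCanonicalModel
open Literature.NumberTheory.ComplexMultiplication
open Literature.NumberTheory.Automorphic
open Literature.NumberTheory.Automorphic.Liu2021 Literature.NumberTheory.Automorphic.Liu2021.AppendixC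
open Literature.NumberTheory.Automorphic.Liu2021.AppendixC.RestOne
open Literature.NumberTheory.Automorphic.Liu2021.Def411WeilCarriers (lineOf locF Rep)
open Summit.HodgeConjecture.CorCM.Transposition.OmegaTransport (realUnit)
open HodgeCM.Model.ArchSideTerm (e₁)
open Literature.NumberTheory.GelbartRogawski1991 Literature.NumberTheory.GelbartRogawski1991.UnitaryDualPair
open Literature.NumberTheory.GelbartRogawski1991.UnitaryDualPair.LocalSplitting (localMu norm_localMu continuous_localMu localMu_toLocalRing_eq_one_iff)
open Literature.RepresentationTheory Literature.RepresentationTheory.Liu2021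
open Summit.HodgeConjecture.CorCM.Transposition

/-! ### Notation (local, no declarations): the pinned dictionary of record, the App-C datum, the tail of the rest of record -/

set_option quotPrecheck false

/-- the PINNED DICTIONARY OF RECORD at `(V, ι₁, a₀)` over the five `_holds` rows (the `h418` binder's dictionary, ✔ `PortJoin/Closed.lean`). -/
local notation "𝔇⟦" V "," ι₁ "," a₀ "⟧" =>
  liuDictionaryPin exists_isReal_hodgeModel_holds hodgePQ_independent_of_hodgeModel_holds BallQuotient.ballQuotientUniformised_holds
    (cmAbelianVarietyRealised_of_eigenbasis exists_isReal_hodgeModel_holds hodgePQ_independent_of_hodgeModel_holds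
      cmAbelianVarietyEigenbasisRealised_holds)
    Literature.NumberTheory.Transcendental.arapura2012_cor_15_4_6_holds V (I V (repAt a₀) (muLiu ι₁ GramClass.rep))
    (line V (repAt a₀) (muLiu ι₁ GramClass.rep))

/-- the App-C standing datum of record `sec42DataOf h isoOf F ι₁ V Φ` ([Liu21, §4.2 ∕ App. C]) at the ported codes. -/
local notation "ℭ⟦" h "," F "," ι₁ "," V "," Φ "⟧" =>
  sec42DataOf h isoOf ⟨HodgeCM.CMField.K F⟩ ι₁
    ⟨HodgeCM.HermSpace3.Hm V, HodgeCM.HermSpace3.isHermitian V, HodgeCM.HermSpace3.signature_ι₁ V, HodgeCM.HermSpace3.posDef_of_ne V⟩ Φ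

/-- the TAIL OF THE REST OF RECORD at `μ` ([Liu21, Def. 4.5 (2), Def. 4.16, Rem. 4.17]: the chosen `D_μ ∈ 𝒜(μ)` with its `(λ_μ, r_μ)` of
Def. 4.5, `Ω(μ)` with the Hecke translates' action): `restTailOne id ι₁ hμ hw (ofPolDR μ (PolDR ι₁ hμ (RMuForm ι₁ hμ))) (𝒯.rhoΩOne …)`. -/
local notation "𝔱⟦" h "," h6 "," F "," ι₁ "," V "," Φ "," μ "," hμ "," hw "⟧" =>
  restTailOne (AlgHom.id ℚ _) ι₁ hμ hw (Def45.Carriers.ofPolDR μ (Def45.PolDR ι₁ hμ (Def45.RMuForm ι₁ hμ)))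
    ((heckeTranslatesFamilyOf heckeTranslate_definedOver_holds h isoOf ⟨HodgeCM.CMField.K F⟩ ι₁
      ⟨HodgeCM.HermSpace3.Hm V, HodgeCM.HermSpace3.isHermitian V, HodgeCM.HermSpace3.signature_ι₁ V, HodgeCM.HermSpace3.posDef_of_ne V⟩ Φ
      h6).rhoΩOne (AlgHom.id ℚ _) ι₁ hμ hw (Def45.Carriers.ofPolDR μ (Def45.PolDR ι₁ hμ (Def45.RMuForm ι₁ hμ))))

/-- the INDEX OF RECORD `LiuIndex.I V (repAt a₀) (muLiu ι₁ rep)` and its lines (port layer 69; the `h418` binder's enumeration). -/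
local notation "𝕀⟦" V "," ι₁ "," a₀ "⟧" => I V (repAt a₀) (muLiu ι₁ GramClass.rep)
local notation "𝕃⟦" V "," ι₁ "," a₀ "⟧" => line V (repAt a₀) (muLiu ι₁ GramClass.rep)

/-- the representative section of record at the index line `i` (re-points Def. 4.12's collection at the package's line `⟨u_{a_i}⟩`). -/
local notation "𝕣⟦" F "," a₀ "," i "⟧" =>
  Rep.update ↥(maximalRealSubfield (HodgeCM.CMField.K F)) (imagUnitSq (HodgeCM.CMField.K F))
    (Rep.ofLineOf ↥(maximalRealSubfield (HodgeCM.CMField.K F)) (imagUnitSq (HodgeCM.CMField.K F)))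
    (locF ↥(maximalRealSubfield (HodgeCM.CMField.K F)) (imagUnitSq (HodgeCM.CMField.K F))
      (realUnit ⟨HodgeCM.CMField.K F⟩ (repAt a₀ (Sigma.fst i)).1 (repAt a₀ (Sigma.fst i)).2.1 (repAt a₀ (Sigma.fst i)).2.2))
    (realUnit ⟨HodgeCM.CMField.K F⟩ (repAt a₀ (Sigma.fst i)).1 (repAt a₀ (Sigma.fst i)).2.1 (repAt a₀ (Sigma.fst i)).2.2) rfl

/-- the μ-UNIFORM WEIL CARRIERS OF RECORD at the index line `i` (own-htheta ✔ `Model.uniformOmegaRep` at `δ′ = (2δ_F)⁻¹`, section 𝕣). -/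
local notation "𝕌⟦" h "," F "," ι₁ "," V "," Φ "," a₀ "," i "⟧" =>
  uniformOmegaRep h ⟨HodgeCM.CMField.K F⟩ ι₁
    ⟨HodgeCM.HermSpace3.Hm V, HodgeCM.HermSpace3.isHermitian V, HodgeCM.HermSpace3.signature_ι₁ V, HodgeCM.HermSpace3.posDef_of_ne V⟩ Φ
    e₁ (frameD V) (frameD_real V) (frameD_ne V) (ιVE V) (2 * imagUnit (HodgeCM.CMField.K F))⁻¹ (fun _ _ => 𝕣⟦F, a₀, i⟧)


/-! ## §S  The socket -/

set_option synthInstance.maxHeartbeats 400000 in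
set_option maxHeartbeats 3200000 in
/-- **The (c)+(d) socket at the ι₁ pin of record.**  The J record `M ∕ jH ∕ hjHinj ∕ hjH` ([Liu21, (4.3) ∕ Rem. 4.17], in the abstract
currency `Map43RationalData` of `PinSignatures`) and the `pieces` (`HcmPieces`: the Albanese-on-pieces package below `Level.capThree C.S.K₀`),
per index line `i` and every conjugate-symplectic weight-one `μ`, at the rests of record `(uniformOmegaRep … (2 * imagUnit F)⁻¹ …).rest
(restTailOne (AlgHom.id ℚ F) ι₁ …)` — the SHARED ι₁-presented tail on which the Ω-pin's `σ ∕ e` and `hLiu'` also live.  Field types = END §A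
binder types VERBATIM (end-1 `ClosedPrinted.lean` v6 fdfcda659219 :161–:190, the KEYED form: every family carries
`(hΦμ : IdeleClassGroup.HasCMType F μ (line i).lineType)`).  Pure packaging; no inhabitant claimed — by DECISION #14 ∕ the coordinator's VERDICT
(MIS-KEY ∕ (c-S), 21:28Z) the family is believed NOT jointly inhabitable at good `PhiMu` lines with non-zero block under the ι₁ keying; the
socket is where the kernel records whatever a route delivers, and its conjugate-tagged twin (`V.conj`, ῑ₁) is where the re-key lands. -/
structure SocketCD (F : HodgeCM.CMField) [IsGalois ℚ (F : Type)] (h6 : 6 ≤ Module.finrank ℚ (F : Type))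
    {ι₁ : (F : Type) →+* ℂ} (V : HodgeCM.HermSpace3 F ι₁) (a₀ : RealScalar F) (h : exists_recordSystem)
    (Φ : CMType (F : Type)) where
  -- (c) the J record in PinSignatures' abstract currency ([Liu21, (4.3) ∕ Rem. 4.17]: a rational form of `H` with its `U(V)(𝔸_f)`-action),
  --     KEYED at `Φ_μ = (line i).lineType` (referee F2 ∕ end-1 v6: demanded only at the Ω-slot's `μ_i`, via the `hcm` conjunct of `hΩ`)
  M : ∀ (i : 𝕀⟦V, ι₁, a₀⟧) (μ : Literature.NumberTheory.Automorphic.IdeleClassGroup (F : Type) →ₜ* Circle)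
    (hμ : IdeleClassGroup.IsConjugateSymplectic (F : Type) μ) (hw : IdeleClassGroup.HasWeight (F : Type) μ 1) (hΦμ : IdeleClassGroup.HasCMType (F : Type) μ (𝕃⟦V, ι₁, a₀⟧ i).lineType),
    (toThm418Data _ ((𝕌⟦h, F, ι₁, V, Φ, a₀, i⟧).rest 𝔱⟦h, h6, F, ι₁, V, Φ, μ, hμ, hw⟧)).Map43RationalData
  jH : ∀ (i : 𝕀⟦V, ι₁, a₀⟧) (μ : Literature.NumberTheory.Automorphic.IdeleClassGroup (F : Type) →ₜ* Circle)
    (hμ : IdeleClassGroup.IsConjugateSymplectic (F : Type) μ) (hw : IdeleClassGroup.HasWeight (F : Type) μ 1) (hΦμ : IdeleClassGroup.HasCMType (F : Type) μ (𝕃⟦V, ι₁, a₀⟧ i).lineType),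
    (M i μ hμ hw hΦμ).HB →ₗ[ℂ] (𝔇⟦V, ι₁, a₀⟧).H
  hjHinj : ∀ (i : 𝕀⟦V, ι₁, a₀⟧) (μ : Literature.NumberTheory.Automorphic.IdeleClassGroup (F : Type) →ₜ* Circle)
    (hμ : IdeleClassGroup.IsConjugateSymplectic (F : Type) μ) (hw : IdeleClassGroup.HasWeight (F : Type) μ 1) (hΦμ : IdeleClassGroup.HasCMType (F : Type) μ (𝕃⟦V, ι₁, a₀⟧ i).lineType),
    Function.Injective (jH i μ hμ hw hΦμ)
  hjH : ∀ (i : 𝕀⟦V, ι₁, a₀⟧) (μ : Literature.NumberTheory.Automorphic.IdeleClassGroup (F : Type) →ₜ* Circle)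
    (hμ : IdeleClassGroup.IsConjugateSymplectic (F : Type) μ) (hw : IdeleClassGroup.HasWeight (F : Type) μ 1) (hΦμ : IdeleClassGroup.HasCMType (F : Type) μ (𝕃⟦V, ι₁, a₀⟧ i).lineType) (g : ↥V.adelicFin) (x : (M i μ hμ hw hΦμ).HB),
    jH i μ hμ hw hΦμ ((M i μ hμ hw hΦμ).ρB g x) = MonoidAlgebra.of ℂ ↥V.adelicFin g • jH i μ hμ hw hΦμ x
  -- (d) the pieces below the threshold `Level.capThree C.S.K₀` (Albanese-on-pieces S2 ∕ S3 ∕ S4 at the pinned dictionary, tower `CohC (pms F ι₁ V K) 1`)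
  pieces : ∀ (i : 𝕀⟦V, ι₁, a₀⟧) (μ : Literature.NumberTheory.Automorphic.IdeleClassGroup (F : Type) →ₜ* Circle)
    (hμ : IdeleClassGroup.IsConjugateSymplectic (F : Type) μ) (hw : IdeleClassGroup.HasWeight (F : Type) μ 1) (hΦμ : IdeleClassGroup.HasCMType (F : Type) μ (𝕃⟦V, ι₁, a₀⟧ i).lineType) (K : HodgeCM.Level V),
    K ≤ HodgeCM.Level.capThree (V := V) ((ℭ⟦h, F, ι₁, V, Φ⟧).S.K₀.1 : Subgroup ↥V.adelicFin) (ℭ⟦h, F, ι₁, V, Φ⟧).S.K₀.2.1 →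
    HcmPieces.{0, 1, 0} (toThm418Data _ ((𝕌⟦h, F, ι₁, V, Φ, a₀, i⟧).rest 𝔱⟦h, h6, F, ι₁, V, Φ, μ, hμ, hw⟧)) (M i μ hμ hw hΦμ) (𝔇⟦V, ι₁, a₀⟧).H (jH i μ hμ hw hΦμ) K.K
      ((HodgeCM.Model.picardCMUniverse exists_isReal_hodgeModel_holds hodgePQ_independent_of_hodgeModel_holds
          BallQuotient.ballQuotientUniformised_holds
          (cmAbelianVarietyRealised_of_eigenbasis exists_isReal_hodgeModel_holds hodgePQ_independent_of_hodgeModel_holds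
            cmAbelianVarietyEigenbasisRealised_holds)).CohC
        ((HodgeCM.Model.picardCMUniverse exists_isReal_hodgeModel_holds hodgePQ_independent_of_hodgeModel_holds
          BallQuotient.ballQuotientUniformised_holds
          (cmAbelianVarietyRealised_of_eigenbasis exists_isReal_hodgeModel_holds hodgePQ_independent_of_hodgeModel_holds
            cmAbelianVarietyEigenbasisRealised_holds)).pms F ι₁ V K) 1)
      (resTotal exists_isReal_hodgeModel_holds hodgePQ_independent_of_hodgeModel_holds
        (ballQuotientUniformisedDatum_of BallQuotient.ballQuotientUniformised_holds)
        (cmAbelianVarietyRealised_of_eigenbasis exists_isReal_hodgeModel_holds hodgePQ_independent_of_hodgeModel_holds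
          cmAbelianVarietyEigenbasisRealised_holds)
        Literature.NumberTheory.Transcendental.arapura2012_cor_15_4_6_holds K)
      ((𝔇⟦V, ι₁, a₀⟧).cmClasses K i)

end Summit.HodgeConjecture.CorCM.D2Bridge

end
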